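import Literature.MathematicalPhysics.QuantumFieldTheory.Balaban1983to89.B7Prop5GeneralInduction
import Summits.QuantumFields.BalabanUV.T4Continuum.Support.ShellMeasureAverageMajorantPdev
import Summits.QuantumFields.BalabanUV.T4Continuum.Support.ShellMeasureAverageLocality148

/-!
# [B7] PROPOSITION 5 AT A GENERAL REGULAR BACKGROUND, k-UNIFORM — file 1 of the assembly: the bridges to b07-g4's operators
# and the PER-LEVEL DISCHARGE of the one-step binders of `B7Prop5GeneralInduction` from rows S68 (a), S68 (b), S55, S56
# (`ShellMeasureAverageProp5Levels`; the Proposition itself is assembled in the sibling `ShellMeasureAverageProp5General`)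

Audit cell `pub-balaban`, sub-cell `t4`, NE7c ROUND-2 crew seat `b2b-balaban-t4-ne7c-formalise-leaf-10` gen 10; owner table
`t4/b2b-balaban-t4-ne7c-p1/LEAVES-NE7c-P1.md` row **S68 (c)** «[B7] Prop. 5 at a general regular background — the k-fold
composition» (cut l.15650 accepted by the owner l.15880; (a) = leaf-05-g7, (b) = leaf-04-g5, (c) = this seat).  INPUTS BY NAME
(none restated): this seat's Literature reproductions `B7Prop5GeneralOperators` ∕ `…OperatorFacts` ((139)–(142) operators and
facts on kernel columns), `B7Prop5GeneralLinear` ((143)–(147) per bond over the majorant (139) as hypothesis),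
`B7Prop5GeneralInduction` ((149)–(157) per bond over (139), (148), locality as hypotheses); row S68 (a) = leaf-05-g7's
`ShellMeasureAverageMajorantPdev.norm_linQcov_le_majorant_of_pdev` ((139) in majorant form at a general background, b07-g4's
`B7BlockGeometry.Qav ∕ Qdd`); row S68 (b) = leaf-04-g5's `ShellMeasureAverageLocality148.{Ccov_congr, ineq148_general,
differentiableOn_Ccov_insCfg}` ((148) + locality of (89)∕(122)); row S55 (`B7Prop3GeneralTild.linQcov_add ∕ _smul`,
`ShellMeasureAverageProp3Discharge.loopReg_of_pdev`); row S56 (`B7Prop4GeneralLevels.level_regularity`,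
`ShellMeasureAverageProp4General.prop4_general_bounds`, `C1cov`, `O1cov`, `two_mul_le_betaMax`); row S64
(`ShellMeasureLandauCorrectionB7.scaleIns`, `landauCf`).

THE PRINTED STATEMENT ([Balaban1985Averaging] p. 42, Proposition 5): «The functional derivative of Q_k(U₀, ηA) is a bounded
function for α₀, α₁ sufficiently small, and we have the bounds |(δ∕δA_b)Q_k(U₀, ηA, c)| ≦ 1 + 2C′₁α₀ + C₃|A| < 1 + 2C′₁α₀ + C₃α₁,
(156) |(δ∕δA_b)C_k(U₀, A, c)| ≦ C₃|A| < C₃α₁. (157)» with (147) «|Q_k(U₀; c, b)| ≦ 1 + 2C′₁α₀» for the linear part.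

WHAT THIS FILE PROVES (kernel, 0 sorry), for `L ≥ 2`, a structure group `G` (`AvgClosed d L G`), a background `U₀` `G`-valued with
«(52)» `pdev U₀ < α₀L^{−2k}`, `C₀α₀ ≤ 1∕3`, `4α₀ ≤ c₂′(d,L)`:
* §1 the BRIDGES between b07-g4's operators and this seat's: `(L:ℝ)·Qav L g (z,κ) = avQ L g (Lz) κ` (IDENTITY; the corner
  `blockBase L z = L•z` as in `B8Eq119TwistedAxial.blockBase_eq_smul`, inlined) and
  `Qdd L g (z,κ) ≤ ddQ L g (Lz) κ` (`qppBonds ⊆ S1`: same box `B(c₋) ∪ B(c₊)`);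
* §2 the per-level DISCHARGES at the backgrounds `Ū₀ʲ = avgIter L U₀ j`, `j ≤ k` (`level_data`): additivity∕homogeneity of the
  one-step linear part (`hadd_levels`, `hsmul_levels`), the majorant (139) with `θ = thetaCov d L α₀ = 3200(d+1)(d+4)L^{d+1}α₀`
  (`h139_levels` ← S68 (a)), locality of `C(Ū₀ʲ, ·)(c)` (`hloc_levels` ← S68 (b)), (148) with `ρ = c₃∕4`, `C″ = C1ppCov d L =
  4·C1cov·L^{d+2}` and differentiability (`h148_levels`, `hdiff_levels` ← S68 (b));
* §3 **PROPOSITION 5 AT A GENERAL BACKGROUND, k-UNIFORM, PER BOND** in `B`-variables: `prop5_general_147` (the composed linear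
  part: `‖LʲηQ_j(U₀)(Xδ_b)(c)‖ ≤ (1 + θ(Lʲη)²)·Lʲ·L^{−jd}·‖X‖`, zero unless `b ⊂ Bʲ(c₋) ∪ Bʲ(c₊)`), **`prop5_general_157`**
  (`‖dC_j(B; Xδ_b)(c)‖ ≤ C3cov·(Lʲ)²·L^{−jd}·b·‖X‖`, `C3cov d L = 16·C1ppCov d L`, locality), `prop5_general_156` — under the
  displayed smallness `h145` («16dC′₁L^{−4}α₀ ≦ 1») and `h155` (print's (155) in the per-bond bookkeeping), BOTH INDEPENDENT OF
  `k` once the field size enters as `Lᵏb = |A|`;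
* §4 **(P5-d) THE PER-BOND FACE FOR ROW S64's `landauCf`** (END-II's Landau correction in the `A`-currency): for `b ∈ S`,
  `c ∈ S′`, `‖∂∕∂A_b landauCf(A)(c)·X‖ ≤ C3cov d L·‖A‖·L^{−kd}·‖X‖` as a `HasLineDerivAt` in the direction `Pi.single b X`
  (`hasLineDerivAt_landauCf_single`) — leaf-08-g12's (72)-TYPE input «[4] Prop. 5: bounded local derivative of the averaging
  map's nonlinear part», k-UNIFORM; the locality half `= 0 unless b ⊂ Bᵏ(c₋) ∪ Bᵏ(c₊)` is leaf-04-g5's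
  `fderiv_landauCf_apply_single_eq_zero`.
HONEST (cell): B7-level bookkeeping on OUR side of WALL §2 (a) (W-a (Cf′)); constants explicit but not optimised (print: «C₃ > C″₁
and α₀, α₁ sufficiently small»); the `η^d`-weighted pairing (138) is rendered per bond as in b07's `B7Prop5Flat` (DIVERGENCE
D-b07g18.1); Prop. 7 (complex background) untouched; nothing of Bałaban's live-level estimates discharged; NOTHING in the
countdown moves; «NE7c ⇐ the named binders»; NE7c NOT PRINTED, NOT PROVED; spine PROVED 0∕9; rung (B)+1 on a FINITE T⁴ — NOT
infinite volume, NOT mass gap, NOT Clay.  HONEST DEPENDENCY: continuum YM on T⁴ ⇐ BetaPertH ∧ nine spine estimates (0/9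
proved); BetaPertH ⇐ (D1) ∧ (D4) ∧ CAP+tail; G-an2-4 gates asym, D1 and NE2/3/4.
-/

noncomputable section

open scoped BigOperators
open NormedSpace Finset Metric

namespace Summit.QuantumFields.BalabanUV.T4Continuum.ShellMeasureAverageProp5Levels

open Literature.MathematicalPhysics.QuantumFieldTheory.Balaban1983to89
open Literature.MathematicalPhysics.QuantumLattice (ZdEdge blockBase blockSites)
open B7Prop1Explicit B7Prop1Local B7Prop2Explicit B7Prop3Flat B7Prop4Flat B7Eq92Concrete B7Prop3GeneralLinear
  B7Prop4GeneralLevels B7Ineq148 B7Prop5GeneralOperators B7Prop5GeneralOperatorFacts B7Prop5GeneralLinear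
  B7Prop5GeneralInduction
open B7Prop5Flat (BondIn S1 bump bondsIn mem_bondsIn restr bump_eq_zero_of)
open B7BlockGeometry (Qav Qdd qppBonds twoBlocks mem_qppBonds Qdd_apply')
open B7Prop3GeneralTild (linQcov_add linQcov_smul)
open Summit.QuantumFields.BalabanUV.T4Continuum.ShellMeasureAverageProp3Discharge (loopReg_of_pdev)
open Summit.QuantumFields.BalabanUV.T4Continuum.ShellMeasureAverageProp4General
open Summit.QuantumFields.BalabanUV.T4Continuum.ShellMeasureAverageMajorantPdev
open Summit.QuantumFields.BalabanUV.T4Continuum.ShellMeasureAverageLocality148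
open Summit.QuantumFields.BalabanUV.T4Continuum.ShellMeasureLandauCorrectionB7

export B7Prop1Explicit (Site)

variable {d : ℕ} {𝔸 : Type*} [NormedRing 𝔸] [NormedAlgebra ℂ 𝔸] [CompleteSpace 𝔸] [NormOneClass 𝔸]

/-! ## §1 Bridges: b07-g4's `Qav`∕`Qdd` on `ZdEdge d → ℝ` versus this seat's `avQ`∕`ddQ` -/

omit [NormedRing 𝔸] [NormedAlgebra ℂ 𝔸] [CompleteSpace 𝔸] [NormOneClass 𝔸] in
/-- **`L·Q = avQ`** (IDENTITY): print's `Q` of (139) in b07-g4's typing (`B7BlockGeometry.Qav`, normalised `L^{−(d+1)}`) times the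
un-normalisation `L` of (122) is this seat's `avQ`. [cite: Balaban1985Averaging, (139) p.39, (125) p.36] -/
theorem mul_Qav_eq_avQ (L : ℕ) (hL : 0 < L) (g : ZdEdge d → ℝ) (z : Site d) (κ : Fin d) :
    (L : ℝ) * Qav L g (z, κ) = avQ L (fun x μ => g (x, μ)) ((L : ℤ) • z) κ := by
  have hbb : blockBase L z = (L : ℤ) • z := funext fun i => by simp [blockBase]
  rw [Qav_eq_sum_boxVec L hL g z κ, avQ, hbb, Finset.mul_sum]
  refine Finset.sum_congr rfl fun r _ => ?_
  rw [Finset.mul_sum, Finset.mul_sum, Finset.sum_range]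
  refine Finset.sum_congr rfl fun i _ => ?_
  have hL0 : (L : ℝ) ≠ 0 := by exact_mod_cast hL.ne'
  have hc : (L : ℝ) * ((L : ℝ) ^ (d + 1))⁻¹ = ((L : ℝ) ^ d)⁻¹ := by
    rw [pow_succ, mul_inv, mul_comm (((L : ℝ) ^ d)⁻¹), ← mul_assoc, mul_inv_cancel₀ hL0, one_mul]
  rw [← mul_assoc, hc]

omit [NormedRing 𝔸] [NormedAlgebra ℂ 𝔸] [CompleteSpace 𝔸] [NormOneClass 𝔸] in
/-- the index set «b ⊂ B(c₋) ∪ B(c₊)» of b07-g4 (`qppBonds`, both endpoints in the two blocks) is contained in b07's box of bonds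
`S1 L (Lz) κ` (both endpoints in `[Lz, Lz + (L−1)𝟙 + Le_κ]`) — the same set of sites. [cite: Balaban1985Averaging, (140) p.39, p.24] -/
theorem qppBonds_subset_S1 (L : ℕ) (hL : 0 < L) (z : Site d) (κ : Fin d) :
    qppBonds L (z, κ) ⊆ S1 L ((L : ℤ) • z) κ := by
  have key : ∀ s : Site d, s ∈ twoBlocks L (z, κ) → InBox ((L : ℤ) • z) (bondHi L ((L : ℤ) • z) κ) s := by
    intro s hs
    simp only [twoBlocks, Finset.mem_union, blockSites, Finset.mem_image, Fintype.mem_piFinset, Finset.mem_range] at hs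
    intro i
    simp only [Pi.smul_apply, smul_eq_mul, bondHi]
    rcases hs with ⟨t, ht, hts⟩ | ⟨t, ht, hts⟩
    · have hi := congrFun hts i
      simp only [Pi.add_apply, blockBase] at hi
      have := ht i
      generalize hw : (L : ℤ) * z i = w at hi ⊢
      split_ifs <;> omega
    · have hi := congrFun hts i
      simp only [Pi.add_apply, blockBase, Pi.single_apply, mul_add, mul_ite, mul_one, mul_zero] at hi
      have := ht i
      generalize hw : (L : ℤ) * z i = w at hi ⊢
      split_ifs at hi ⊢ <;> omega
  intro b hb
  rw [mem_qppBonds] at hb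
  exact mem_bondsIn.2 ⟨key _ hb.1, key _ hb.2⟩

omit [NormedRing 𝔸] [NormedAlgebra ℂ 𝔸] [CompleteSpace 𝔸] [NormOneClass 𝔸] in
/-- **`Qdd ≤ ddQ`** on non-negative functions (same weight `L^{−d}`, `qppBonds ⊆ S1`). [cite: Balaban1985Averaging, (140) p.39] -/
theorem Qdd_le_ddQ (L : ℕ) (hL : 0 < L) {g : ZdEdge d → ℝ} (hg : ∀ b, 0 ≤ g b) (z : Site d) (κ : Fin d) :
    Qdd L g (z, κ) ≤ ddQ L (fun x μ => g (x, μ)) ((L : ℤ) • z) κ := by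
  rw [Qdd_apply', ddQ]
  refine mul_le_mul_of_nonneg_left ?_ (by positivity)
  exact Finset.sum_le_sum_of_subset_of_nonneg (qppBonds_subset_S1 L hL z κ) fun b _ _ => hg b

/-! ## §2 The level backgrounds `Ū₀ʲ` and the per-level discharges -/

/-- print's `2C′₁α₀` (post-(144) convention `C′₁ ↔ L²C′₁`) for B7's own average in b07's typing: the coefficient of `(Lʲη)²·L·Q″`
in (139) at the level background `Ū₀ʲ` is `θ·(Lʲη)²·L` with `θ = 3200(d+1)(d+4)L^{d+1}α₀` (S68 (a)'s `1600(d+1)(d+4)L^{d+2}β`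
at `β = 2α₀(Lʲη)²`). [cite: Balaban1985Averaging, (139) p.39, (143)–(144) pp.39–40] -/
def thetaCov (d L : ℕ) (α₀ : ℝ) : ℝ := 3200 * ((d : ℝ) + 1) * ((d : ℝ) + 4) * (L : ℝ) ^ (d + 1) * α₀

/-- print's `C″₁` of (148) for B7's own one-step remainder at a general background: `4·C1cov(d)·L^{d+2}` (S68 (b)'s
`ineq148_general`). [cite: Balaban1985Averaging, (148) p.40] -/
def C1ppCov (d L : ℕ) : ℝ := 4 * C1cov d * (L : ℝ) ^ (d + 2)

/-- print's `C₃` of (149)∕(157) («C₃ > C″₁ … e.g. we may take C₃ = 6C″₁»; the per-bond bookkeeping takes `16C″₁`). [cite: Balaban1985Averaging, (155) p.41, Prop. 5 p.42] -/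
def C3cov (d L : ℕ) : ℝ := 16 * C1ppCov d L

omit [NormOneClass 𝔸] in
/-- `thetaCov ≥ 0` for `α₀ ≥ 0`. [folklore] -/
theorem thetaCov_nonneg (d L : ℕ) {α₀ : ℝ} (hα : 0 ≤ α₀) : 0 ≤ thetaCov d L α₀ := by unfold thetaCov; positivity

/-- `C1ppCov > 0` (`L ≥ 1`). [folklore] -/
theorem C1ppCov_pos (d : ℕ) {L : ℕ} (hL : 1 ≤ L) : 0 < C1ppCov d L := by
  have := C1cov_pos d; have : (0 : ℝ) < L := by exact_mod_cast hL
  unfold C1ppCov; positivity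

/-- `C3cov > 0` (`L ≥ 1`). [folklore] -/
theorem C3cov_pos (d : ℕ) {L : ℕ} (hL : 1 ≤ L) : 0 < C3cov d L := by
  have := C1ppCov_pos d hL; unfold C3cov; positivity

section Regime

variable (L : ℕ) (hL : 2 ≤ L) {G : Subgroup 𝔸ˣ} (hG : AvgClosed d L G) (k : ℕ)
  (U₀ : Site d → Fin d → 𝔸ˣ) (hU₀ : ∀ x κ, U₀ x κ ∈ G) {α₀ : ℝ} (hα : 0 < α₀)
  (hα3 : C0 d * α₀ ≤ 1 / 3) (hα4 : 4 * α₀ ≤ c2' d L) (h52 : pdev U₀ < α₀ * (((L : ℝ) ^ k)⁻¹) ^ 2)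

include hL hG hU₀ hα hα3 hα4 h52 in
/-- **the level data** (Proposition 2 at every level, row S56's `level_regularity`): for `j ≤ k`, `Ū₀ʲ` is `U1`-valued with plaquette
deviation `< 2α₀(Lʲ∕Lᵏ)² ≤ βmax = 1∕(1024(d+1)(d+4)L²)`. [cite: Balaban1985Averaging, Prop. 2 (53)–(54) p.26, p.37 (after (127))] -/
theorem level_data (j : ℕ) (hj : j ≤ k) :
    (∀ x κ', avgIter L U₀ j x κ' ∈ U1 𝔸) ∧
      0 ≤ 2 * (α₀ * ((L : ℝ) ^ j * ((L : ℝ) ^ k)⁻¹) ^ 2) ∧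
      pdev (avgIter L U₀ j) < 2 * (α₀ * ((L : ℝ) ^ j * ((L : ℝ) ^ k)⁻¹) ^ 2) ∧
      2 * (α₀ * ((L : ℝ) ^ j * ((L : ℝ) ^ k)⁻¹) ^ 2) ≤ 1 / (1024 * ((d : ℝ) + 1) * ((d : ℝ) + 4) * (L : ℝ) ^ 2) := by
  have hL1 : 1 ≤ L := le_trans (by norm_num) hL
  have hα2 : 2 * α₀ ≤ c2' d L := by linarith
  have hreg := level_regularity L hL hG k U₀ hU₀ hα hα3 hα2 h52 j hj
  have hL1r : (1 : ℝ) ≤ L := by exact_mod_cast hL1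
  have hLk : (0 : ℝ) < (L : ℝ) ^ k := by positivity
  have hratio : (L : ℝ) ^ j * ((L : ℝ) ^ k)⁻¹ ≤ 1 := by
    rw [mul_inv_le_iff₀ hLk, one_mul]; exact pow_le_pow_right₀ hL1r hj
  have h1 : ((L : ℝ) ^ j * ((L : ℝ) ^ k)⁻¹) ^ 2 ≤ 1 := by
    rw [← one_pow 2]; exact pow_le_pow_left₀ (by positivity) hratio 2
  have hβmax : 2 * (α₀ * ((L : ℝ) ^ j * ((L : ℝ) ^ k)⁻¹) ^ 2)
      ≤ 1 / (1024 * ((d : ℝ) + 1) * ((d : ℝ) + 4) * (L : ℝ) ^ 2) := by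
    have := two_mul_le_betaMax (d := d) hα4
    nlinarith [mul_le_mul_of_nonneg_left h1 hα.le]
  exact ⟨fun x κ' => hG.le_U1 (hreg.2 x κ'), by positivity, hreg.1, hβmax⟩

include hL hG hU₀ hα hα3 hα4 h52 in
/-- block loops of every level background are within `1` of the unit at every `L`-bond (`loopReg_of_pdev`, row S55) — the
hypothesis of `linQcov_add ∕ _smul`. [folklore] -/
theorem level_loops (j : ℕ) (hj : j ≤ k) (q : Site d) (κ : Fin d) :
    ∀ r : Fin d → Fin L, ‖((Wcx L (avgIter L U₀ j) q κ (boxVec L r) : 𝔸ˣ) : 𝔸) - 1‖ < 1 := by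
  have hL1 : 1 ≤ L := le_trans (by norm_num) hL
  obtain ⟨hV, hβ0, hβ, hβmax⟩ := level_data L hL hG k U₀ hU₀ hα hα3 hα4 h52 j hj
  obtain ⟨hloop, hsmall⟩ := loopReg_of_pdev hL1 hV hβ0 hβ hβmax q κ
  exact fun r => ((hloop r).trans hsmall).trans_lt (by norm_num)

include hL hG hU₀ hα hα3 hα4 h52 in
/-- **`hadd` at the levels**: the one-step linear part at `Ū₀ʲ` is additive (row S55's `linQcov_add`). [cite: Balaban1985Averaging, (122) p.36] -/
theorem hadd_levels : ∀ j < k, ∀ (F G' : Site d → Fin d → 𝔸) (z : Site d) (κ : Fin d),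
    linQcov L (avgIter L U₀ j) (F + G') ((L : ℤ) • z) κ =
      linQcov L (avgIter L U₀ j) F ((L : ℤ) • z) κ + linQcov L (avgIter L U₀ j) G' ((L : ℤ) • z) κ :=
  fun j hj F G' z κ => linQcov_add L _ F G' _ κ (level_loops L hL hG k U₀ hU₀ hα hα3 hα4 h52 j hj.le ((L : ℤ) • z) κ)

include hL hG hU₀ hα hα3 hα4 h52 in
/-- **`hsmul` at the levels**: the one-step linear part at `Ū₀ʲ` is `ℂ`-homogeneous (row S55's `linQcov_smul`). [cite: Balaban1985Averaging, (122) p.36] -/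
theorem hsmul_levels : ∀ j < k, ∀ (t : ℂ) (F : Site d → Fin d → 𝔸) (z : Site d) (κ : Fin d),
    linQcov L (avgIter L U₀ j) (t • F) ((L : ℤ) • z) κ = t • linQcov L (avgIter L U₀ j) F ((L : ℤ) • z) κ :=
  fun j hj t F z κ => linQcov_smul L _ t F _ κ (level_loops L hL hG k U₀ hU₀ hα hα3 hα4 h52 j hj.le ((L : ℤ) • z) κ)

include hL hG hU₀ hα hα3 hα4 h52 in
/-- **`h139` at the levels — (139) IN MAJORANT FORM at `Ū₀ʲ` (row S68 (a), leaf-05-g7's `norm_linQcov_le_majorant_of_pdev` with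
`β = 2α₀(Lʲ∕Lᵏ)²`), in this seat's currency**: `‖L(Q(Ū₀ʲ)G)_c‖ ≤ avQ L |G| (c) + θ·(Lʲ∕Lᵏ)²·L·ddQ L |G| (c)`,
`θ = thetaCov d L α₀`. [cite: Balaban1985Averaging, (139) p.39, (144) p.40] -/
theorem h139_levels : ∀ j < k, ∀ (G' : Site d → Fin d → 𝔸) (z : Site d) (κ : Fin d),
    ‖linQcov L (avgIter L U₀ j) G' ((L : ℤ) • z) κ‖ ≤
      avQ L (fun x κ' => ‖G' x κ'‖) ((L : ℤ) • z) κ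
        + thetaCov d L α₀ * ((L : ℝ) ^ j * ((L : ℝ) ^ k)⁻¹) ^ 2 * (L : ℝ) *
          ddQ L (fun x κ' => ‖G' x κ'‖) ((L : ℤ) • z) κ := by
  intro j hj G' z κ
  have hL1 : 1 ≤ L := le_trans (by norm_num) hL
  have hL0 : 0 < L := hL1
  obtain ⟨hV, hβ0, hβ, hβmax⟩ := level_data L hL hG k U₀ hU₀ hα hα3 hα4 h52 j hj.le
  have h := norm_linQcov_le_majorant_of_pdev L hV hL1 z κ (g := fun b : ZdEdge d => ‖G' b.1 b.2‖)
    (fun x μ => le_rfl) hβ0 hβ.le hβmax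
  have hbb : blockBase L z = (L : ℤ) • z := funext fun i => by simp [blockBase]
  rw [hbb] at h
  have h1 : (L : ℝ) * Qav L (fun b : ZdEdge d => ‖G' b.1 b.2‖) (z, κ) = avQ L (fun x κ' => ‖G' x κ'‖) ((L : ℤ) • z) κ :=
    mul_Qav_eq_avQ L hL0 _ z κ
  have h2 : Qdd L (fun b : ZdEdge d => ‖G' b.1 b.2‖) (z, κ) ≤ ddQ L (fun x κ' => ‖G' x κ'‖) ((L : ℤ) • z) κ :=
    Qdd_le_ddQ L hL0 (fun b => norm_nonneg _) z κ
  have hcoef : 0 ≤ 1600 * ((d : ℝ) + 1) * ((d : ℝ) + 4) * (L : ℝ) ^ (d + 2) * (2 * (α₀ * ((L : ℝ) ^ j * ((L : ℝ) ^ k)⁻¹) ^ 2)) := by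
    positivity
  have hθ : 1600 * ((d : ℝ) + 1) * ((d : ℝ) + 4) * (L : ℝ) ^ (d + 2) * (2 * (α₀ * ((L : ℝ) ^ j * ((L : ℝ) ^ k)⁻¹) ^ 2))
      = thetaCov d L α₀ * ((L : ℝ) ^ j * ((L : ℝ) ^ k)⁻¹) ^ 2 * (L : ℝ) := by
    rw [thetaCov, pow_succ]; ring
  calc ‖linQcov L (avgIter L U₀ j) G' ((L : ℤ) • z) κ‖
      ≤ (L : ℝ) * Qav L (fun b : ZdEdge d => ‖G' b.1 b.2‖) (z, κ)
          + 1600 * ((d : ℝ) + 1) * ((d : ℝ) + 4) * (L : ℝ) ^ (d + 2) * (2 * (α₀ * ((L : ℝ) ^ j * ((L : ℝ) ^ k)⁻¹) ^ 2))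
            * Qdd L (fun b : ZdEdge d => ‖G' b.1 b.2‖) (z, κ) := h
    _ ≤ avQ L (fun x κ' => ‖G' x κ'‖) ((L : ℤ) • z) κ
          + 1600 * ((d : ℝ) + 1) * ((d : ℝ) + 4) * (L : ℝ) ^ (d + 2) * (2 * (α₀ * ((L : ℝ) ^ j * ((L : ℝ) ^ k)⁻¹) ^ 2))
            * ddQ L (fun x κ' => ‖G' x κ'‖) ((L : ℤ) • z) κ := by
        rw [h1]; exact add_le_add le_rfl (mul_le_mul_of_nonneg_left h2 hcoef)
    _ = _ := by rw [hθ]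

omit [NormOneClass 𝔸] in
include hL in
/-- **`hloc` at the levels** — LOCALITY of `C(Ū₀ʲ, ·)(c)` in the bonds of `B(c₋) ∪ B(c₊)` (row S68 (b), leaf-04-g5's `Ccov_congr`).
[cite: Balaban1985Averaging, p.34, p.31 (after (91))] -/
theorem hloc_levels : ∀ j < k, ∀ (F F' : Site d → Fin d → 𝔸) (z : Site d) (κ : Fin d),
    AgreeOn ((L : ℤ) • z) (bondHi L ((L : ℤ) • z) κ) F F' →
      Ccov L (avgIter L U₀ j) F ((L : ℤ) • z) κ = Ccov L (avgIter L U₀ j) F' ((L : ℤ) • z) κ :=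
  fun _ _ _ _ _ κ h => Ccov_congr L (le_trans (by norm_num) hL) _ κ agreeOn_rfl h

include hL hG hU₀ hα hα3 hα4 h52 in
/-- **`h148` at the levels** — (148) for `C(Ū₀ʲ, ·, c)` on the box variables with `ρ = c₃∕4`, `C″ = 4·C1cov·L^{d+2}` (row S68 (b),
leaf-04-g5's `ineq148_general`). [cite: Balaban1985Averaging, (148) p.40] -/
theorem h148_levels : ∀ j < k, ∀ (z : Site d) (κ : Fin d),
    Ineq148Printed (fun a : ↥(S1 L ((L : ℤ) • z) κ) → 𝔸 =>
      Ccov L (avgIter L U₀ j) (insCfg (S1 L ((L : ℤ) • z) κ) a) ((L : ℤ) • z) κ) (L : ℝ) d (c3 d L / 4) (C1ppCov d L) := by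
  intro j hj z κ
  obtain ⟨hV, hβ0, hβ, hβmax⟩ := level_data L hL hG k U₀ hU₀ hα hα3 hα4 h52 j hj.le
  exact ineq148_general (le_trans (by norm_num) hL) hV hβ0 hβ hβmax _ _ κ

include hL hG hU₀ hα hα3 hα4 h52 in
/-- **`hdiff` at the levels** — differentiability of `a ↦ C(Ū₀ʲ, ins a, c)` at the points `‖a‖ < c₃∕4` (row S68 (b), leaf-04-g5's
`differentiableOn_Ccov_insCfg` on the ball of radius `c₃`). [cite: Balaban1985Averaging, Prop. 3 p.36, (148) p.40] -/
theorem hdiff_levels : ∀ j < k, ∀ (z : Site d) (κ : Fin d) (a : ↥(S1 L ((L : ℤ) • z) κ) → 𝔸), ‖a‖ < c3 d L / 4 →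
    DifferentiableAt ℂ (fun a : ↥(S1 L ((L : ℤ) • z) κ) → 𝔸 =>
      Ccov L (avgIter L U₀ j) (insCfg (S1 L ((L : ℤ) • z) κ) a) ((L : ℤ) • z) κ) a := by
  intro j hj z κ a ha
  have hL1 : 1 ≤ L := le_trans (by norm_num) hL
  obtain ⟨hV, hβ0, hβ, hβmax⟩ := level_data L hL hG k U₀ hU₀ hα hα3 hα4 h52 j hj.le
  refine (differentiableOn_Ccov_insCfg hL1 hV hβ0 hβ hβmax _ _ κ).differentiableAt (isOpen_ball.mem_nhds ?_)
  rw [mem_ball_zero_iff]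
  linarith [c3_pos d hL1]


end Regime

end Summit.QuantumFields.BalabanUV.T4Continuum.ShellMeasureAverageProp5Levels

end
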